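import Summits.BirchSwinnertonDyer.BirchSwinnertonDyer.Theorems.EisensteinPrimesBSDpOnCellCOfLZZRoadIoo
import Summits.BirchSwinnertonDyer.Rank1Residual.X2.CellCBDPValueLZZRoadInputOfFact
import HarnessLib

/-!
# Crux 4 `BSDpOnCellC` (stmt-BirchSwinnertonDyer-19034), line b1 v9: `stub_c2`, the crux at the PRE tier and the ψ-even
# door FROM THE REFEREED LIU–ZHANG–ZHANG FACT by name — the END of the chain of record of COMMISSION (O2)-LZZ@3 (cell
# `bsd-eis`, seat `bsd-eis-cgshw` g15; RULINGS L43 (2) / L56 (5) / L57 «FACT-door + census sentence + MEMO-19: cgshw»)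

HONEST FRAMING (cell `bsd-eis`, run/shared/lean/pub/bsd-eis/): theorems only (three compositions); nothing booked; X2 stays
CONSTRUCTION-SHAPED; no label or count moves by this file; BSD is not proved by any of this. Every theorem is CONDITIONAL on
its displayed binders, ALL of which are now NAMED LITERATURE FACTS (no typed input left on the value side):
(a) `LiuZhangZhang2018.thm151_thm153_modularCurve_heegnerVector` — Liu–Zhang–Zhang, Duke Math. J. 167 (2018) Thm. 1.5.1
(with Remark 1.1.2) ∧ Thm. 1.5.3 for `X₀(N) → E`, the Heegner test vector and `χ = 𝟙` at a prime `p ‖ N` split in `K`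
[REFEREED; typed p509230 with its cited readings R-D/R-D′/R-N2/R-P/R-M/R-M′/R-N3/R-Ad/R-CNF/R-L, lit §82/§86];
(b) the 16 published named facts + [cas-split] (= v9 `stub_publishedFacts` VERBATIM);
(c) Keller–Yin arXiv:2402.12781v2 Thm. D BY NAME [PREPRINT; printed proof gapped at L1754, flag KYD-gap];
(d) for the whole cell only — crux 3 `MazurMCOnCellB` (stmt-…-19033).
THE CHAIN (all ACCEPTED, axioms standard): FACT (a) ⟹ `X2.lzzRoadInputIoo_of_thm151_thm153` (k5-c4 g7,
`X2/CellCBDPValueLZZRoadInputOfFact.lean`; (AV-p) from p510618, the «∀ ι_K» step from p511336) ⟹ `X2.LZZRoadInputIoo`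
(p512118) ⟹ `X2.bdpValueContinuousDisplayAt_of_lzzRoadInputIoo` (p512988, = cgshw g14's rescale p509400) ⟹
`X2.BDPValueContinuousDisplayAt W 3` ⟹ `Reoriented.stub_c2_of_continuousDisplay_three` (p503213) ⟹ v9's `stub_c2` ⟹ the
ψ-even door (p497161's, re-pointed in p514810).

* `stub_c2_of_thm151_thm153` : FACT (a) `→` v9's `stub_c2` VERBATIM — the value half of crux 4 at `p = 3`, both signs,
  is REFEREED-LITERATURE-grade (the first value theorem at `3 ‖ N` consumed by the kernel; no kernel `sorry`, no typed input).
* `bsdpOnCellC_of_thm151_thm153_of_thmD_OPEN` : (b) + (a) + (c) + (d) ⊢ `BSDpOnCellC` (route decl BY NAME) — crux 4 at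
  the PRE tier with NO typed input: residue = {KY Thm. D [PRE]} ∪ {crux 3}.
* **`bsdpOnCellCNotGV_of_thm151_thm153_of_thmD_OPEN`** : (b) + (a) + (c) ⊢ `∀ W p, CellC W p → ¬GVPar W p → BSDp W p` —
  NO crux 3. CENSUS SENTENCE (planner's to book; nothing moves here): on every ψ-even B11 entry — `CellCNonsplitNotGV`
  2 552 @3 + `CellCSplitNotGV` 7 429 @3 = 9 981 classes (the 409 @5/@7 are closed `literal:T-EISX2CD` since ROUND 547) —
  BSD(E,p) follows from PUBLISHED/REFEREED named facts + Keller–Yin Thm. D alone: tier word «literal on KY Thm D alone».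

What this is NOT: not a proof of Thm. D, of any main conjecture, or of BSD for any curve unconditionally; not a count
move (the planner's OFFER in the B11EVEN5 pattern does that, cells stay as labelled); the readings of (a) are the
referee's to score (lit §86 ledger: all anchored). Novel here: nothing mathematical — by-name composition.

References: [LiuZhangZhang2018] Duke Math. J. 167 (2018) Thm. 1.5.1, Remark 1.1.2, Thm. 1.5.3 (pp. 745–749) = arXiv:1511.08172
Thm. 1.6/1.8; [KellerYin2024] Thm. D = Thm. 5.1.3 (PRE); [Castella2018Exceptional] Thms. 2.10–2.11; [Hsieh2014] Thm. 1;
[GreenbergVatsal2000] Thm. (1.3); [CastellaEtAl2021] Thm. 5.3.1; [Miller2011LMS] Def. 1.1; RULINGS L43 / L53 / L56 / L57;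
c2v MEMO-1/2; cgshw MEMO-18/19; lit LIT-DOSSIER §82, §86.
-/

set_option autoImplicit false
set_option linter.dupNamespace false

noncomputable section

open scoped Classical MatrixGroups ModularForm

open CongruenceSubgroup WeierstrassCurve NumberField IsDedekindDomain Field PowerSeries
  Literature.NumberTheory.EllipticCurves Literature.NumberTheory.EllipticCurves.GreenbergSelmer
  Literature.NumberTheory.EllipticCurves.ModularForms Literature.NumberTheory.QuadraticFields
  Literature.NumberTheory.EllipticCurves.Rank1Residual
  Literature.NumberTheory.EllipticCurves.Rank1Residual.Typed
  Literature.NumberTheory.EllipticCurves.GreenbergVatsal2000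
  Literature.NumberTheory.EllipticCurves.Wuthrich2014
  Literature.NumberTheory.EllipticCurves.SteinWuthrich2013
  Literature.NumberTheory.EllipticCurves.Castella2018Exceptional
  Literature.NumberTheory.GaloisRepresentations Literature.NumberTheory.GaloisCohomology
  Literature.NumberTheory.Automorphic
  Summit.BirchSwinnertonDyer.Rank1Residual.X11b.AcSelmer
  Summit.BirchSwinnertonDyer.Rank1Residual.X11b.Halves
  Summit.BirchSwinnertonDyer.Rank1Residual.X11b
  Summit.BirchSwinnertonDyer.Rank1Residual.X2
  Summit.BirchSwinnertonDyer.Rank1Residual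

namespace Summit.BirchSwinnertonDyer.BirchSwinnertonDyer.Theorems.Reoriented

/-- **v9's `stub_c2` from the REFEREED Liu–Zhang–Zhang fact** (Duke 167 Thm. 1.5.1 ∧ 1.5.3 at `p ‖ N`, typed p509230):
`stub_c2_of_lzzRoadInputIoo ∘ X2.lzzRoadInputIoo_of_thm151_thm153`. The value half of crux 4 at `p = 3` (both signs, over
the wide receptacle) thereby rests on a refereed named fact and kernel theorems only. CONDITIONAL on that fact (hypothesis);
nothing booked. [cite: LiuZhangZhang2018, Thm. 1.5.1 and Remark 1.1.2 and Thm. 1.5.3 (Duke 167 pp. 745–749)] -/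
theorem stub_c2_of_thm151_thm153 (hF : LiuZhangZhang2018.thm151_thm153_modularCurve_heegnerVector) :
    (∀ (W : WeierstrassCurve ℚ) [W.IsElliptic] [W.IsGloballyMinimal] (p : ℕ) [Fact p.Prime],
        p = 3 → CellC W p → ¬ W.HasSplitMultiplicativeReductionAtPrime p → NonsplitBDPValueOnTreeInt W p) ∧
      (∀ (W : WeierstrassCurve ℚ) [W.IsElliptic] [W.IsGloballyMinimal] (p : ℕ) [Fact p.Prime],
        p = 3 → CellC W p → W.HasSplitMultiplicativeReductionAtPrime p → SplitBDPValueOnTreeInt W p) :=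
  stub_c2_of_lzzRoadInputIoo (X2.lzzRoadInputIoo_of_thm151_thm153 hF)

/-- **Crux 4 `BSDpOnCellC` AT THE PRE TIER WITH NO TYPED INPUT:** from the 16 published facts + [cas-split] (`hPub`), the
REFEREED LZZ fact (`hF`), Keller–Yin Thm. D BY NAME (`hD`, PREPRINT, gapped) and crux 3 (`hMCB`).
= `bsdpOnCellC_of_lzzRoadInputIoo_of_thmD_OPEN ∘ X2.lzzRoadInputIoo_of_thm151_thm153`. A `conditional-result`: credits
nothing, books nothing. [claim: KellerYin2024, status: under-review]
[cite: KellerYin2024, Thm. D = Thm. 5.1.3 (arXiv:2402.12781v2 L306–L309)]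
[cite: LiuZhangZhang2018, Thm. 1.5.1 and Thm. 1.5.3 (Duke 167 pp. 748–749)]
[cite: Castella2018Exceptional, Thm. 2.10 and Thm. 2.11 (arXiv:1507.04260 pp. 13–14)]
[cite: Hsieh2014, Thm. 1 (arXiv:1112.1580 pp. 3–4)] [cite: CastellaEtAl2021, Thm. 5.3.1] [cite: Miller2011LMS, Def. 1.1] -/
theorem bsdpOnCellC_of_thm151_thm153_of_thmD_OPEN
    (hPub : (lambdaMu_multiplicative_of_gvPar ∧ thm16_charIdeal_dvd_multiplicative_of_reducible ∧
      thm61_splitMultiplicative ∧ thm61_nonsplitMultiplicative ∧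
      (∀ (W : WeierstrassCurve ℚ) [W.IsElliptic] [W.IsGloballyMinimal] (p : ℕ) [Fact p.Prime],
        greenberg_stevens (W := W) (p := p)) ∧
      exists_isNewformOf ∧
      (∀ (K : Type) [Field K] [NumberField K], poitouTate_selmerStructure_duality K) ∧
      (∀ (K : Type) [Field K] [NumberField K], poitouTate_sha_tateDual K) ∧
      hsieh2014_exists_anticyclotomicPAdicLFunction ∧
      (∀ (N : ℕ) [NeZero N] (W : WeierstrassCurve ℚ) (K : Type) [Field K] [NumberField K],
        gross_zagier N W K) ∧
      (∀ (N : ℕ) [NeZero N] (W : WeierstrassCurve ℚ) (K : Type) [Field K] [NumberField K],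
        kolyvagin N W K) ∧
      rank_eq_analyticRank_of_analyticRank_le_one ∧ HoffsteinLuo1997_exists_twist_L_one_ne_zero ∧
      mazur_not_dvd_maninConstant_of_odd ∧ bsdRHS_eq_of_isIsogenous) ∧
      thm210_thm211_bdpDisplay_pNew)
    (hF : LiuZhangZhang2018.thm151_thm153_modularCurve_heegnerVector)
    (hD : KellerYin2024.thmD_imcMult_exists_isBDPLFunction_isTorsion_charIdeal_eq_OPEN)
    (hMCB : Summit.BirchSwinnertonDyer.BirchSwinnertonDyer.Theses.EisensteinPrimes.MazurMCOnCellB) :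
    Summit.BirchSwinnertonDyer.BirchSwinnertonDyer.Theses.EisensteinPrimes.BSDpOnCellC :=
  bsdpOnCellC_of_lzzRoadInputIoo_of_thmD_OPEN hPub (X2.lzzRoadInputIoo_of_thm151_thm153 hF) hD hMCB

/-- **The ψ-EVEN DOOR at every odd `p` with NO typed input and NO crux 3: `CellC ∩ {¬GVPar} ⇒ BSD(E,p)` from the 16
published facts + [cas-split] (`hPub`), the REFEREED LZZ fact (`hF`) and Keller–Yin Thm. D BY NAME (`hD`).**
= `bsdpOnCellCNotGV_of_lzzRoadInputIoo_of_thmD_OPEN ∘ X2.lzzRoadInputIoo_of_thm151_thm153`. CENSUS SENTENCE (the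
planner books; no label moves here): every ψ-even B11 entry (`CellCNonsplitNotGV` 2 552 + `CellCSplitNotGV` 7 429 = 9 981
classes @3; 409 @5/@7 already `literal:T-EISX2CD`) reads «literal on Keller–Yin Thm. D alone» by THIS NAME — every other
binder is a published/refereed named fact of the Literature library. A `conditional-result`.
[claim: KellerYin2024, status: under-review] [cite: KellerYin2024, Thm. D = Thm. 5.1.3 (arXiv:2402.12781v2 L306–L309)]
[cite: LiuZhangZhang2018, Thm. 1.5.1 and Thm. 1.5.3 (Duke 167 pp. 748–749)]
[cite: GreenbergVatsal2000, Thm. (1.3) and §2 p. 28] [cite: Hsieh2014, Thm. 1 (arXiv:1112.1580 pp. 3–4)]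
[cite: CastellaEtAl2021, Thm. 5.3.1] [cite: Miller2011LMS, Def. 1.1] -/
theorem bsdpOnCellCNotGV_of_thm151_thm153_of_thmD_OPEN
    (hPub : (lambdaMu_multiplicative_of_gvPar ∧ thm16_charIdeal_dvd_multiplicative_of_reducible ∧
      thm61_splitMultiplicative ∧ thm61_nonsplitMultiplicative ∧
      (∀ (W : WeierstrassCurve ℚ) [W.IsElliptic] [W.IsGloballyMinimal] (p : ℕ) [Fact p.Prime],
        greenberg_stevens (W := W) (p := p)) ∧
      exists_isNewformOf ∧
      (∀ (K : Type) [Field K] [NumberField K], poitouTate_selmerStructure_duality K) ∧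
      (∀ (K : Type) [Field K] [NumberField K], poitouTate_sha_tateDual K) ∧
      hsieh2014_exists_anticyclotomicPAdicLFunction ∧
      (∀ (N : ℕ) [NeZero N] (W : WeierstrassCurve ℚ) (K : Type) [Field K] [NumberField K],
        gross_zagier N W K) ∧
      (∀ (N : ℕ) [NeZero N] (W : WeierstrassCurve ℚ) (K : Type) [Field K] [NumberField K],
        kolyvagin N W K) ∧
      rank_eq_analyticRank_of_analyticRank_le_one ∧ HoffsteinLuo1997_exists_twist_L_one_ne_zero ∧
      mazur_not_dvd_maninConstant_of_odd ∧ bsdRHS_eq_of_isIsogenous) ∧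
      thm210_thm211_bdpDisplay_pNew)
    (hF : LiuZhangZhang2018.thm151_thm153_modularCurve_heegnerVector)
    (hD : KellerYin2024.thmD_imcMult_exists_isBDPLFunction_isTorsion_charIdeal_eq_OPEN) :
    ∀ (W : WeierstrassCurve ℚ) [W.IsElliptic] [W.IsGloballyMinimal] (p : ℕ) [Fact p.Prime],
      CellC W p → ¬ GVPar W p → BSDp W p :=
  bsdpOnCellCNotGV_of_lzzRoadInputIoo_of_thmD_OPEN hPub (X2.lzzRoadInputIoo_of_thm151_thm153 hF) hD

end Summit.BirchSwinnertonDyer.BirchSwinnertonDyer.Theorems.Reoriented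

end
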